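import Summits.FinalStateConjecture.FinalStateConjecture.Theorems.PhotonSphereChannelsExteriorEnergyRW

/-!
# Route PhotonSphereChannels — the two sheets of the cone-flux identity

Helper file (H2, first half, of the route to stub `stub_futureSilentWavesVanish`, line
`isolated-kerr-connected-hull`, crux stmt-FinalStateConjecture-14075), over the Literature vocabulary
`ReggeWheeler.{energyDensity, IsSolution}`.  For a global `C²` solution `φ` of
`φ_tt − φ_xx + Vφ = 0`, `V ≥ 0` differentiable, a centre `xc` and `t ≥ 0`:

* `RW.lintegral_Ioi_eq_add_of_forall`, `RW.lintegral_Iio_eq_add_of_forall` — squeeze lemmas turning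
  two-sided finite-interval bounds into an identity of half-line `lintegral`s;
* `RW.lintegral_Ioi_energy_eq_add_coneFlux` — the energy on `(xc, ∞)` at time `0` equals the energy
  on `(xc + t, ∞)` at time `t` plus the flux `∫_0^t ((φ_t + φ_x)² + Vφ²)(τ, xc + τ) dτ` through the
  right sheet of the forward light cone of `(0, xc)`;
* `RW.lintegral_Iio_energy_eq_add_coneFlux` — the same on `(−∞, xc)` / `(−∞, xc − t)` with the flux
  `∫_0^t ((φ_t − φ_x)² + Vφ²)(τ, xc − τ) dτ` through the left sheet.

Proof: the affine energy identity `WaveEnergy.energy_identity_affine` on the half-regions, closed by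
an auxiliary outgoing (resp. ingoing) null outer boundary whose flux has a sign, and squeezed as that
boundary recedes — no decay of the solution is needed, the energies may be infinite.  The two-sided
identity `E(0) = E_ext(t) + flux` and its `t → ∞` form are in the sequel
`PhotonSphereChannelsChannelsResolveTameDevelopmentsRConeFlux`.  No new definitions; standard
material [folklore].
-/

namespace Summit.FinalStateConjecture.FinalStateConjecture.Theorems

-- the tree's namespace `Summit.FinalStateConjecture.FinalStateConjecture.Theorems` repeats a component
-- by design (statement file `Summits/FinalStateConjecture/FinalStateConjecture/…`), as in every landed
-- `…Theorems` file of this route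
set_option linter.dupNamespace false

open MeasureTheory Set Filter Topology intervalIntegral
open Literature.Geometry.Lorentzian Literature.Geometry.Lorentzian.ReggeWheeler

noncomputable section

namespace RW

/-! ### Two squeeze lemmas: half-line `lintegral`s from two-sided finite-interval bounds -/

section Squeeze

/-- Right half-lines: if the pieces `∫_a^{a+n} f + F` are dominated by some `∫_b^{R'} g` and the
pieces `∫_b^{b+n} g` by some `∫_a^{R'} f + F` (`F ≥ 0`; `f, g` continuous non-negative), then
`∫⁻_{(b,∞)} g = ∫⁻_{(a,∞)} f + F`. [folklore] -/
theorem lintegral_Ioi_eq_add_of_forall {f g : ℝ → ℝ} (hf : Continuous f) (hg : Continuous g)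
    (hf0 : ∀ x, 0 ≤ f x) (hg0 : ∀ x, 0 ≤ g x) {a b F : ℝ} (hF : 0 ≤ F)
    (h1 : ∀ n : ℕ, ∃ R', b ≤ R' ∧ (∫ x in a..(a + n), f x) + F ≤ ∫ x in b..R', g x)
    (h2 : ∀ n : ℕ, ∃ R', a ≤ R' ∧ ∫ x in b..(b + n), g x ≤ (∫ x in a..R', f x) + F) :
    ∫⁻ x in Ioi b, ENNReal.ofReal (g x)
      = (∫⁻ x in Ioi a, ENNReal.ofReal (f x)) + ENNReal.ofReal F := by
  have hdir : ∀ c : ℝ, Directed (· ⊆ ·) (fun n : ℕ ↦ Ioc c (c + n)) := fun c ↦ by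
    refine Monotone.directed_le fun i j hij ↦ Ioc_subset_Ioc le_rfl ?_
    exact add_le_add_right (Nat.cast_le.mpr hij) c
  apply le_antisymm
  · rw [← WaveEnergy.iUnion_Ioc_add_nat b, setLIntegral_iUnion_of_directed _ (hdir b)]
    refine iSup_le fun n ↦ ?_
    obtain ⟨R', hR', hle⟩ := h2 n
    have hbn : b ≤ b + n := le_add_of_nonneg_right (Nat.cast_nonneg n)
    rw [WaveEnergy.lintegral_Ioc_eq_ofReal_intervalIntegral hg hg0 hbn]
    calc ENNReal.ofReal (∫ x in b..(b + n), g x)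
        ≤ ENNReal.ofReal ((∫ x in a..R', f x) + F) := ENNReal.ofReal_le_ofReal hle
      _ = ENNReal.ofReal (∫ x in a..R', f x) + ENNReal.ofReal F :=
          ENNReal.ofReal_add (intervalIntegral.integral_nonneg hR' fun x _ ↦ hf0 x) hF
      _ = (∫⁻ x in Ioc a R', ENNReal.ofReal (f x)) + ENNReal.ofReal F := by
          rw [WaveEnergy.lintegral_Ioc_eq_ofReal_intervalIntegral hf hf0 hR']
      _ ≤ (∫⁻ x in Ioi a, ENNReal.ofReal (f x)) + ENNReal.ofReal F := by
          gcongr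
          exact Ioc_subset_Ioi_self
  · rw [← WaveEnergy.iUnion_Ioc_add_nat a, setLIntegral_iUnion_of_directed _ (hdir a),
      ENNReal.iSup_add]
    refine iSup_le fun n ↦ ?_
    obtain ⟨R', hR', hle⟩ := h1 n
    have han : a ≤ a + n := le_add_of_nonneg_right (Nat.cast_nonneg n)
    rw [WaveEnergy.lintegral_Ioc_eq_ofReal_intervalIntegral hf hf0 han,
      ← ENNReal.ofReal_add (intervalIntegral.integral_nonneg han fun x _ ↦ hf0 x) hF]
    calc ENNReal.ofReal ((∫ x in a..(a + n), f x) + F)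
        ≤ ENNReal.ofReal (∫ x in b..R', g x) := ENNReal.ofReal_le_ofReal hle
      _ = ∫⁻ x in Ioc b R', ENNReal.ofReal (g x) :=
          (WaveEnergy.lintegral_Ioc_eq_ofReal_intervalIntegral hg hg0 hR').symm
      _ ≤ ∫⁻ x in Ioi b, ENNReal.ofReal (g x) := lintegral_mono_set Ioc_subset_Ioi_self

/-- Left half-lines: if the pieces `∫_{a−n}^{a} f + G` are dominated by some `∫_{R'}^{b} g` and the
pieces `∫_{b−n}^{b} g` by some `∫_{R'}^{a} f + G` (`G ≥ 0`; `f, g` continuous non-negative), then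
`∫⁻_{(−∞,b)} g = ∫⁻_{(−∞,a)} f + G`. [folklore] -/
theorem lintegral_Iio_eq_add_of_forall {f g : ℝ → ℝ} (hf : Continuous f) (hg : Continuous g)
    (hf0 : ∀ x, 0 ≤ f x) (hg0 : ∀ x, 0 ≤ g x) {a b G : ℝ} (hG : 0 ≤ G)
    (h1 : ∀ n : ℕ, ∃ R', R' ≤ b ∧ (∫ x in (a - n)..a, f x) + G ≤ ∫ x in R'..b, g x)
    (h2 : ∀ n : ℕ, ∃ R', R' ≤ a ∧ ∫ x in (b - n)..b, g x ≤ (∫ x in R'..a, f x) + G) :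
    ∫⁻ x in Iio b, ENNReal.ofReal (g x)
      = (∫⁻ x in Iio a, ENNReal.ofReal (f x)) + ENNReal.ofReal G := by
  have hdir : ∀ c : ℝ, Directed (· ⊆ ·) (fun n : ℕ ↦ Ioc (c - n) c) := fun c ↦ by
    refine Monotone.directed_le fun i j hij ↦ Ioc_subset_Ioc ?_ le_rfl
    exact sub_le_sub_left (Nat.cast_le.mpr hij) c
  rw [setLIntegral_congr (Iio_ae_eq_Iic (μ := volume) (a := b)),
    setLIntegral_congr (Iio_ae_eq_Iic (μ := volume) (a := a))]
  apply le_antisymm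
  · rw [← WaveEnergy.iUnion_Ioc_sub_nat b, setLIntegral_iUnion_of_directed _ (hdir b)]
    refine iSup_le fun n ↦ ?_
    obtain ⟨R', hR', hle⟩ := h2 n
    have hbn : b - n ≤ b := sub_le_self b (Nat.cast_nonneg n)
    rw [WaveEnergy.lintegral_Ioc_eq_ofReal_intervalIntegral hg hg0 hbn]
    calc ENNReal.ofReal (∫ x in (b - n)..b, g x)
        ≤ ENNReal.ofReal ((∫ x in R'..a, f x) + G) := ENNReal.ofReal_le_ofReal hle
      _ = ENNReal.ofReal (∫ x in R'..a, f x) + ENNReal.ofReal G :=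
          ENNReal.ofReal_add (intervalIntegral.integral_nonneg hR' fun x _ ↦ hf0 x) hG
      _ = (∫⁻ x in Ioc R' a, ENNReal.ofReal (f x)) + ENNReal.ofReal G := by
          rw [WaveEnergy.lintegral_Ioc_eq_ofReal_intervalIntegral hf hf0 hR']
      _ ≤ (∫⁻ x in Iic a, ENNReal.ofReal (f x)) + ENNReal.ofReal G := by
          gcongr
          exact Ioc_subset_Iic_self
  · rw [← WaveEnergy.iUnion_Ioc_sub_nat a, setLIntegral_iUnion_of_directed _ (hdir a),
      ENNReal.iSup_add]
    refine iSup_le fun n ↦ ?_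
    obtain ⟨R', hR', hle⟩ := h1 n
    have han : a - n ≤ a := sub_le_self a (Nat.cast_nonneg n)
    rw [WaveEnergy.lintegral_Ioc_eq_ofReal_intervalIntegral hf hf0 han,
      ← ENNReal.ofReal_add (intervalIntegral.integral_nonneg han fun x _ ↦ hf0 x) hG]
    calc ENNReal.ofReal ((∫ x in (a - n)..a, f x) + G)
        ≤ ENNReal.ofReal (∫ x in R'..b, g x) := ENNReal.ofReal_le_ofReal hle
      _ = ∫⁻ x in Ioc R' b, ENNReal.ofReal (g x) :=
          (WaveEnergy.lintegral_Ioc_eq_ofReal_intervalIntegral hg hg0 hR').symm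
      _ ≤ ∫⁻ x in Iic b, ENNReal.ofReal (g x) := lintegral_mono_set Ioc_subset_Iic_self

end Squeeze

/-! ### The cone-flux identities -/

section ConeFlux

variable {V : ℝ → ℝ} {φ : ℝ → ℝ → ℝ}

/-- Dictionary (`he` format of the `WaveEnergy` files) for `e := fun z ↦ energyDensity V φ z.1 z.2`.
[folklore] -/
theorem energyDensity_he' (hφ : ContDiff ℝ 2 (Function.uncurry φ)) :
    ∀ z : ℝ × ℝ, (fun z : ℝ × ℝ ↦ energyDensity V φ z.1 z.2) z
      = (fderiv ℝ (Function.uncurry φ) z (1, 0)) ^ 2 + (fderiv ℝ (Function.uncurry φ) z (0, 1)) ^ 2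
        + V z.2 * Function.uncurry φ z ^ 2 := by
  rintro ⟨t, x⟩
  simp only [Function.uncurry_apply_pair]
  unfold energyDensity
  rw [WaveEnergy.deriv_slice_fst_eq hφ, WaveEnergy.deriv_slice_snd_eq hφ]

/-- Dictionary (`hsol` format of the `WaveEnergy` files) for a global solution. [folklore] -/
theorem IsSolution.fderiv_eq' (hφ : IsSolution V φ) :
    ∀ z : ℝ × ℝ, fderiv ℝ (fderiv ℝ (Function.uncurry φ)) z (1, 0) (1, 0)
      - fderiv ℝ (fderiv ℝ (Function.uncurry φ)) z (0, 1) (0, 1)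
      + V z.2 * Function.uncurry φ z = 0 := by
  rintro ⟨t, x⟩
  rw [← WaveEnergy.iteratedDeriv_two_slice_fst_eq hφ.1,
    ← WaveEnergy.iteratedDeriv_two_slice_snd_eq hφ.1]
  exact hφ.2 (t, x)

/-- **Right sheet of the cone-flux identity.** For a global `C²` solution (`V ≥ 0` differentiable),
a centre `xc` and `t ≥ 0`: the energy on `(xc, ∞)` at time `0` equals the energy on `(xc + t, ∞)` at
time `t` plus the flux `∫_0^t ((φ_t + φ_x)² + Vφ²)(τ, xc + τ) dτ` through the right-moving null
segment from `(0, xc)`. [folklore] -/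
theorem lintegral_Ioi_energy_eq_add_coneFlux (hV : Differentiable ℝ V) (hV0 : ∀ x, 0 ≤ V x)
    (hφ : IsSolution V φ) (xc : ℝ) {t : ℝ} (ht : 0 ≤ t) :
    ∫⁻ x in Ioi xc, ENNReal.ofReal (energyDensity V φ 0 x)
      = (∫⁻ x in Ioi (xc + t), ENNReal.ofReal (energyDensity V φ t x))
        + ENNReal.ofReal (∫ τ in 0..t,
            ((deriv (fun σ ↦ φ σ (xc + τ)) τ + deriv (φ τ) (xc + τ)) ^ 2
              + V (xc + τ) * φ τ (xc + τ) ^ 2)) := by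
  have hu : ContDiff ℝ 2 (Function.uncurry φ) := hφ.1
  set e : ℝ × ℝ → ℝ := fun z ↦ energyDensity V φ z.1 z.2 with he_def
  have he := energyDensity_he' (V := V) hu
  set m : ℝ × ℝ → ℝ := fun z ↦ 2 * fderiv ℝ (Function.uncurry φ) z (1, 0)
    * fderiv ℝ (Function.uncurry φ) z (0, 1) with hm_def
  have hm : ∀ z, m z = 2 * fderiv ℝ (Function.uncurry φ) z (1, 0)
      * fderiv ℝ (Function.uncurry φ) z (0, 1) := fun z ↦ rfl
  have hsol := IsSolution.fderiv_eq' hφ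
  have hec : Continuous e := WaveEnergy.continuous_energyDensity hu hV he
  have hmc : Continuous m := WaveEnergy.continuous_momentumDensity hu hm
  have he0 : ∀ z, 0 ≤ e z := WaveEnergy.energyDensity_nonneg hV0 he
  have hme : ∀ z, m z ≤ e z := WaveEnergy.momentum_le_energy hV0 he hm
  have hme' : ∀ z, -m z ≤ e z := WaveEnergy.neg_momentum_le_energy hV0 he hm
  -- the flux density through the right sheet, and its Literature form
  set P : ℝ → ℝ := fun τ ↦ m (τ, xc + τ) + e (τ, xc + τ) with hP_def
  have hPc : Continuous P := by
    simp only [hP_def]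
    fun_prop
  have hP0 : ∀ τ, 0 ≤ P τ := fun τ ↦ by
    have := hme' (τ, xc + τ)
    simp only [hP_def]
    linarith
  have hPlit : ∀ τ, P τ = (deriv (fun σ ↦ φ σ (xc + τ)) τ + deriv (φ τ) (xc + τ)) ^ 2
      + V (xc + τ) * φ τ (xc + τ) ^ 2 := by
    intro τ
    simp only [hP_def, hm_def, he_def]
    unfold energyDensity
    rw [WaveEnergy.deriv_slice_fst_eq hu, WaveEnergy.deriv_slice_snd_eq hu]
    ring
  have hFeq : (∫ τ in 0..t, ((deriv (fun σ ↦ φ σ (xc + τ)) τ + deriv (φ τ) (xc + τ)) ^ 2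
      + V (xc + τ) * φ τ (xc + τ) ^ 2)) = ∫ τ in 0..t, P τ :=
    intervalIntegral.integral_congr fun τ _ ↦ (hPlit τ).symm
  rw [hFeq]
  have hF0 : 0 ≤ ∫ τ in 0..t, P τ := intervalIntegral.integral_nonneg ht fun τ _ ↦ hP0 τ
  -- (i) ingoing auxiliary outer boundary `x = B − τ`: its flux `(m − e)` is `≤ 0`
  have key1 : ∀ B : ℝ, (∫ x in (xc + t)..(B - t), e (t, x)) + (∫ τ in 0..t, P τ)
      ≤ ∫ x in xc..B, e (0, x) := by
    intro B
    have key := WaveEnergy.energy_identity_affine hu hV hsol he hm xc 1 B (-1) 0 t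
    have hle : (∫ τ in 0..t, ((m (τ, B + (-1) * τ) + (-1) * e (τ, B + (-1) * τ))
        - (m (τ, xc + 1 * τ) + 1 * e (τ, xc + 1 * τ)))) ≤ ∫ τ in 0..t, -P τ := by
      refine intervalIntegral.integral_mono_on ht ?_ (hPc.neg.intervalIntegrable _ _) ?_
      · apply Continuous.intervalIntegrable
        fun_prop
      · intro τ _
        have h1 := hme (τ, B + (-1) * τ)
        simp only [hP_def, one_mul]
        linarith
    rw [intervalIntegral.integral_neg] at hle
    have e1 : xc + 1 * t = xc + t := by ring
    have e2 : B + (-1) * t = B - t := by ring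
    have e3 : xc + 1 * 0 = xc := by ring
    have e4 : B + (-1) * 0 = B := by ring
    rw [e1, e2, e3, e4] at key
    linarith
  -- (ii) outgoing auxiliary outer boundary `x = B + τ`: its flux `(m + e)` is `≥ 0`
  have key2 : ∀ B : ℝ, (∫ x in xc..B, e (0, x))
      ≤ (∫ x in (xc + t)..(B + t), e (t, x)) + ∫ τ in 0..t, P τ := by
    intro B
    have key := WaveEnergy.energy_identity_affine hu hV hsol he hm xc 1 B 1 0 t
    have hle : (∫ τ in 0..t, -P τ) ≤ ∫ τ in 0..t, ((m (τ, B + 1 * τ) + 1 * e (τ, B + 1 * τ))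
        - (m (τ, xc + 1 * τ) + 1 * e (τ, xc + 1 * τ))) := by
      refine intervalIntegral.integral_mono_on ht (hPc.neg.intervalIntegrable _ _) ?_ ?_
      · apply Continuous.intervalIntegrable
        fun_prop
      · intro τ _
        have h1 := hme' (τ, B + 1 * τ)
        simp only [hP_def, one_mul] at h1 ⊢
        linarith
    rw [intervalIntegral.integral_neg] at hle
    have e1 : xc + 1 * t = xc + t := by ring
    have e2 : B + 1 * t = B + t := by ring
    have e3 : xc + 1 * 0 = xc := by ring
    have e4 : B + 1 * 0 = B := by ring
    rw [e1, e2, e3, e4] at key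
    linarith
  -- squeeze
  have hft : Continuous fun x ↦ e (t, x) := hec.comp (Continuous.prodMk_right t)
  have hf0' : Continuous fun x ↦ e (0, x) := hec.comp (Continuous.prodMk_right 0)
  refine lintegral_Ioi_eq_add_of_forall (f := fun x ↦ e (t, x)) (g := fun x ↦ e (0, x)) hft hf0'
    (fun x ↦ he0 _) (fun x ↦ he0 _) hF0 (fun n ↦ ?_) (fun n ↦ ?_)
  · refine ⟨xc + t + n + t, by linarith, ?_⟩
    have := key1 (xc + t + n + t)
    have e1 : xc + t + ↑n + t - t = xc + t + n := by ring
    rwa [e1] at this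
  · refine ⟨xc + n + t, by linarith, ?_⟩
    have := key2 (xc + n)
    have e1 : xc + ↑n + t = xc + n + t := by ring
    exact this

/-- **Left sheet of the cone-flux identity.** For a global `C²` solution (`V ≥ 0` differentiable),
a centre `xc` and `t ≥ 0`: the energy on `(−∞, xc)` at time `0` equals the energy on `(−∞, xc − t)`
at time `t` plus the flux `∫_0^t ((φ_t − φ_x)² + Vφ²)(τ, xc − τ) dτ` through the left-moving null
segment from `(0, xc)`. [folklore] -/
theorem lintegral_Iio_energy_eq_add_coneFlux (hV : Differentiable ℝ V) (hV0 : ∀ x, 0 ≤ V x)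
    (hφ : IsSolution V φ) (xc : ℝ) {t : ℝ} (ht : 0 ≤ t) :
    ∫⁻ x in Iio xc, ENNReal.ofReal (energyDensity V φ 0 x)
      = (∫⁻ x in Iio (xc - t), ENNReal.ofReal (energyDensity V φ t x))
        + ENNReal.ofReal (∫ τ in 0..t,
            ((deriv (fun σ ↦ φ σ (xc - τ)) τ - deriv (φ τ) (xc - τ)) ^ 2
              + V (xc - τ) * φ τ (xc - τ) ^ 2)) := by
  have hu : ContDiff ℝ 2 (Function.uncurry φ) := hφ.1
  set e : ℝ × ℝ → ℝ := fun z ↦ energyDensity V φ z.1 z.2 with he_def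
  have he := energyDensity_he' (V := V) hu
  set m : ℝ × ℝ → ℝ := fun z ↦ 2 * fderiv ℝ (Function.uncurry φ) z (1, 0)
    * fderiv ℝ (Function.uncurry φ) z (0, 1) with hm_def
  have hm : ∀ z, m z = 2 * fderiv ℝ (Function.uncurry φ) z (1, 0)
      * fderiv ℝ (Function.uncurry φ) z (0, 1) := fun z ↦ rfl
  have hsol := IsSolution.fderiv_eq' hφ
  have hec : Continuous e := WaveEnergy.continuous_energyDensity hu hV he
  have hmc : Continuous m := WaveEnergy.continuous_momentumDensity hu hm
  have he0 : ∀ z, 0 ≤ e z := WaveEnergy.energyDensity_nonneg hV0 he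
  have hme : ∀ z, m z ≤ e z := WaveEnergy.momentum_le_energy hV0 he hm
  have hme' : ∀ z, -m z ≤ e z := WaveEnergy.neg_momentum_le_energy hV0 he hm
  -- the flux density through the left sheet, and its Literature form
  set Q : ℝ → ℝ := fun τ ↦ e (τ, xc - τ) - m (τ, xc - τ) with hQ_def
  have hQc : Continuous Q := by
    simp only [hQ_def]
    fun_prop
  have hQ0 : ∀ τ, 0 ≤ Q τ := fun τ ↦ by
    have := hme (τ, xc - τ)
    simp only [hQ_def]
    linarith
  have hQlit : ∀ τ, Q τ = (deriv (fun σ ↦ φ σ (xc - τ)) τ - deriv (φ τ) (xc - τ)) ^ 2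
      + V (xc - τ) * φ τ (xc - τ) ^ 2 := by
    intro τ
    simp only [hQ_def, hm_def, he_def]
    unfold energyDensity
    rw [WaveEnergy.deriv_slice_fst_eq hu, WaveEnergy.deriv_slice_snd_eq hu]
    ring
  have hGeq : (∫ τ in 0..t, ((deriv (fun σ ↦ φ σ (xc - τ)) τ - deriv (φ τ) (xc - τ)) ^ 2
      + V (xc - τ) * φ τ (xc - τ) ^ 2)) = ∫ τ in 0..t, Q τ :=
    intervalIntegral.integral_congr fun τ _ ↦ (hQlit τ).symm
  rw [hGeq]
  have hG0 : 0 ≤ ∫ τ in 0..t, Q τ := intervalIntegral.integral_nonneg ht fun τ _ ↦ hQ0 τ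
  -- (i) ingoing auxiliary outer boundary `x = A + τ`: its flux term `(m + e)` is `≥ 0`
  have key1 : ∀ A : ℝ, (∫ x in (A + t)..(xc - t), e (t, x)) + (∫ τ in 0..t, Q τ)
      ≤ ∫ x in A..xc, e (0, x) := by
    intro A
    have key := WaveEnergy.energy_identity_affine hu hV hsol he hm A 1 xc (-1) 0 t
    have hle : (∫ τ in 0..t, ((m (τ, xc + (-1) * τ) + (-1) * e (τ, xc + (-1) * τ))
        - (m (τ, A + 1 * τ) + 1 * e (τ, A + 1 * τ)))) ≤ ∫ τ in 0..t, -Q τ := by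
      refine intervalIntegral.integral_mono_on ht ?_ (hQc.neg.intervalIntegrable _ _) ?_
      · apply Continuous.intervalIntegrable
        fun_prop
      · intro τ _
        have h1 := hme' (τ, A + 1 * τ)
        have e0 : xc + (-1) * τ = xc - τ := by ring
        simp only [hQ_def, one_mul, e0] at h1 ⊢
        linarith
    rw [intervalIntegral.integral_neg] at hle
    have e1 : A + 1 * t = A + t := by ring
    have e2 : xc + (-1) * t = xc - t := by ring
    have e3 : A + 1 * 0 = A := by ring
    have e4 : xc + (-1) * 0 = xc := by ring
    rw [e1, e2, e3, e4] at key
    linarith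
  -- (ii) outgoing auxiliary outer boundary `x = A − τ`: its flux term `(m − e)` is `≤ 0`
  have key2 : ∀ A : ℝ, (∫ x in A..xc, e (0, x))
      ≤ (∫ x in (A - t)..(xc - t), e (t, x)) + ∫ τ in 0..t, Q τ := by
    intro A
    have key := WaveEnergy.energy_identity_affine hu hV hsol he hm A (-1) xc (-1) 0 t
    have hle : (∫ τ in 0..t, -Q τ) ≤ ∫ τ in 0..t, ((m (τ, xc + (-1) * τ) + (-1) * e (τ, xc + (-1) * τ))
        - (m (τ, A + (-1) * τ) + (-1) * e (τ, A + (-1) * τ))) := by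
      refine intervalIntegral.integral_mono_on ht (hQc.neg.intervalIntegrable _ _) ?_ ?_
      · apply Continuous.intervalIntegrable
        fun_prop
      · intro τ _
        have h1 := hme (τ, A + (-1) * τ)
        have e0 : xc + (-1) * τ = xc - τ := by ring
        simp only [hQ_def, e0] at h1 ⊢
        linarith
    rw [intervalIntegral.integral_neg] at hle
    have e1 : A + (-1) * t = A - t := by ring
    have e2 : xc + (-1) * t = xc - t := by ring
    have e3 : A + (-1) * 0 = A := by ring
    have e4 : xc + (-1) * 0 = xc := by ring
    rw [e1, e2, e3, e4] at key
    linarith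
  -- squeeze
  have hft : Continuous fun x ↦ e (t, x) := hec.comp (Continuous.prodMk_right t)
  have hf0' : Continuous fun x ↦ e (0, x) := hec.comp (Continuous.prodMk_right 0)
  refine lintegral_Iio_eq_add_of_forall (f := fun x ↦ e (t, x)) (g := fun x ↦ e (0, x)) hft hf0'
    (fun x ↦ he0 _) (fun x ↦ he0 _) hG0 (fun n ↦ ?_) (fun n ↦ ?_)
  · refine ⟨xc - t - n - t, by linarith, ?_⟩
    have := key1 (xc - t - n - t)
    have e1 : xc - t - ↑n - t + t = xc - t - n := by ring
    rwa [e1] at this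
  · refine ⟨xc - n - t, by linarith, ?_⟩
    exact key2 (xc - n)

/-- **Registered sub-goal `stub_futureSilentWavesVanish_H2sheets` of stub L** (crux
stmt-FinalStateConjecture-14075, line `isolated-kerr-connected-hull`): the two sheets of the cone-flux
identity. [folklore] -/
theorem stub_futureSilentWavesVanish_H2sheets :
    ∀ (V : ℝ → ℝ), Differentiable ℝ V → (∀ x, 0 ≤ V x) → ∀ φ : ℝ → ℝ → ℝ,
      ReggeWheeler.IsSolution V φ → ∀ (xc t : ℝ), 0 ≤ t →
        (∫⁻ x in Set.Ioi xc, ENNReal.ofReal (ReggeWheeler.energyDensity V φ 0 x))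
          = (∫⁻ x in Set.Ioi (xc + t), ENNReal.ofReal (ReggeWheeler.energyDensity V φ t x))
            + ENNReal.ofReal (∫ τ in 0..t,
              ((deriv (fun σ ↦ φ σ (xc + τ)) τ + deriv (φ τ) (xc + τ)) ^ 2
                + V (xc + τ) * φ τ (xc + τ) ^ 2)) ∧
        (∫⁻ x in Set.Iio xc, ENNReal.ofReal (ReggeWheeler.energyDensity V φ 0 x))
          = (∫⁻ x in Set.Iio (xc - t), ENNReal.ofReal (ReggeWheeler.energyDensity V φ t x))
            + ENNReal.ofReal (∫ τ in 0..t,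
              ((deriv (fun σ ↦ φ σ (xc - τ)) τ - deriv (φ τ) (xc - τ)) ^ 2
                + V (xc - τ) * φ τ (xc - τ) ^ 2)) :=
  fun _ hV hV0 _ hφ xc _ ht ↦ ⟨lintegral_Ioi_energy_eq_add_coneFlux hV hV0 hφ xc ht,
    lintegral_Iio_energy_eq_add_coneFlux hV hV0 hφ xc ht⟩

end ConeFlux

end RW

end

end Summit.FinalStateConjecture.FinalStateConjecture.Theorems
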